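import Summits.KontsevichZagierPeriods.KontsevichZagierPeriods.Theorems.VietaFibreKernelFormStubBoundedDecomposition
import Summits.KontsevichZagierPeriods.KontsevichZagierPeriods.Theorems.VietaFibreKernelFormCubeAverage
import Summits.KontsevichZagierPeriods.KontsevichZagierPeriods.Theses.VietaFibre
import HarnessLib

/-!
# Crux `KernelForm` (stmt-KontsevichZagierPeriods-10447), line `Sketch`: the averaging normal form

**Theorem** (`exists_cubeRep_integrand_sub_eval_le`). Inside the Kontsevich–Zagier calculus of
`KZCalculus.lean`, every formal `ℤ`-combination `c` of integral representations is, modulo the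
four moves, ONE integral over a unit cube `[0,1]^m` of a `ℚ`-semialgebraic step function which is
uniformly as close as we please to the constant `KZ.eval c`:
for every `ε > 0` there is `W` with `W.domain = KZ.cube m`, `|W.integrand y − eval c| ≤ ε` on the
cube, and `c − [W] ∈ KZ.relations` (the dimension `m` depends on `c` only). In particular
(`exists_cubeRep_abs_integrand_le`) every element of `ker eval` is move-equivalent to cube
integrals of uniformly arbitrarily small integrands.

Proof (Riemann sums inside the rules, crux NOTES §4.4): `c ≡ [A] − [B]` with `A`, `B` bounded
volume forms of one dimension `m` (`stub_boundedDecomposition`), translated into a box `[0, L₀)^m`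
(`KZ.exists_translate_box`); both are replaced by their Riemann averages on the unit cube at a
common dyadic level `j` (`exists_cubeAverage` of `VietaFibreKernelFormCubeAverage.lean`), which are
uniformly within `ε/2` of `vol A`, `vol B` once the thickened frontiers are small
(`abs_cubeAverage_sub_volume_le`); subtract the integrands (rule (1)).

**Corollaries.** `moveInvariant_eq_zero_of_supContinuous` (and `…_of_l1Continuous`,
`moveInvariant_sub_eq_zero_of_value_eq_of_supContinuous`): a move-invariant additive
`θ : KZ.FormalRep →+ ℝ` which is continuous at `0` in the sup norm (a fortiori in the `L¹` norm)
of cube integrands vanishes on `ker eval`, so never separates two representations of one number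
(complements the monotone rigidity of `VietaFibreKernelFormMonotoneInvariants.lean`). `kernelForm_iff_supClosed`: the crux `KernelForm`
(Conjecture 1) is EQUIVALENT to the pure closedness statement "a cube representation which is
move-equivalent to cube representations of uniformly arbitrarily small integrand is move-equivalent
to `0`".
-/

noncomputable section

open MeasureTheory Set Filter Topology
open scoped ENNReal
open Literature.NumberTheory.Transcendental
open Literature.ModelTheory.ExponentialFields (IsSemialgebraic)

namespace Summit.KontsevichZagierPeriods.KernelForm.LocaliseAtValuePrime

variable {m : ℕ}

/-! ### The averaging normal form -/

/-- **Averaging normal form of the Kontsevich–Zagier calculus.** Every formal `ℤ`-combination `c`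
of integral representations is, modulo the four moves, one integral over a unit cube `[0,1]^m` of a
`ℚ`-semialgebraic function uniformly within any prescribed `ε > 0` of the constant `KZ.eval c`
(the dimension `m` depends on `c` only). [cite: Yoshinaga2008, §3.4] [cite: ViuSos2021, §4]
[folklore] -/
theorem exists_cubeRep_integrand_sub_eval_le (c : KZ.FormalRep) :
    ∃ m : ℕ, ∀ ε : ℝ, 0 < ε → ∃ W : KZ.IntegralRep m, W.domain = KZ.cube m ∧
      (∀ y ∈ W.domain, |W.integrand y - KZ.eval c| ≤ ε) ∧ c - KZ.of W ∈ KZ.relations := by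
  -- bounded decomposition and translation into a box
  obtain ⟨k, A, B, hAb, hBb, hA1, hB1, e⟩ := stub_boundedDecomposition c
  obtain ⟨C, hC⟩ := isBounded_iff_forall_norm_le.mp (hAb.union hBb)
  obtain ⟨A', hA'b, hA'1, hboxA, hvA, eA⟩ :=
    KZ.exists_translate_box A hA1 fun x hx => hC x (Or.inl hx)
  obtain ⟨B', hB'b, hB'1, hboxB, hvB, eB⟩ :=
    KZ.exists_translate_box B hB1 fun x hx => hC x (Or.inr hx)
  set L₀ : ℕ := 2 * (⌈C⌉₊ + 1) with hL₀
  refine ⟨k + 1, fun ε hε => ?_⟩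
  -- the value of `c`
  have hval : KZ.eval c = volume.real A'.domain - volume.real B'.domain := by
    have h := KZ.eval_eq_zero_of_mem_relations e
    rw [map_sub, map_sub, KZ.eval_of, KZ.eval_of] at h
    rw [← A'.value_eq_volume_real hA'1, ← B'.value_eq_volume_real hB'1, hvA, hvB]
    linarith
  -- a common grid level
  set η : ℝ := ε / 2 with hη
  have hη0 : 0 ≤ η := by positivity
  have hη' : (0 : ℝ≥0∞) < ENNReal.ofReal η := ENNReal.ofReal_pos.mpr (by positivity)
  obtain ⟨j, hjA, hjB⟩ := ((((tendsto_volume_cthickening_frontier hA'b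
    (volume_frontier_eq_zero_of_isSemialgebraic A'.isSemialgebraic_domain)).eventually
    (ge_mem_nhds hη')).and ((tendsto_volume_cthickening_frontier hB'b
    (volume_frontier_eq_zero_of_isSemialgebraic B'.isSemialgebraic_domain)).eventually
    (ge_mem_nhds hη')))).exists
  set L := L₀ * 2 ^ j with hL
  have hboxA' : ∀ x ∈ A'.domain, ∀ i, 0 ≤ x i ∧ x i * 2 ^ j < L := fun x hx i =>
    ⟨(hboxA x hx i).1, by
      rw [hL, Nat.cast_mul, Nat.cast_pow, Nat.cast_ofNat]
      exact mul_lt_mul_of_pos_right (hboxA x hx i).2 (by positivity)⟩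
  have hboxB' : ∀ x ∈ B'.domain, ∀ i, 0 ≤ x i ∧ x i * 2 ^ j < L := fun x hx i =>
    ⟨(hboxB x hx i).1, by
      rw [hL, Nat.cast_mul, Nat.cast_pow, Nat.cast_ofNat]
      exact mul_lt_mul_of_pos_right (hboxB x hx i).2 (by positivity)⟩
  have gapA := (card_sub_card_mul_le A'.domain j L).trans hjA
  have gapB := (card_sub_card_mul_le B'.domain j L).trans hjB
  -- the two Riemann averages and their difference
  obtain ⟨WA, hWAd, hWAi, eWA⟩ := exists_cubeAverage A' hA'1 j L hboxA'
  obtain ⟨WB, hWBd, hWBi, eWB⟩ := exists_cubeAverage B' hB'1 j L hboxB'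
  have hWsa : IsSemialgebraicFunOn ℚ (KZ.cube (k + 1)) (WA.integrand - WB.integrand) :=
    IsSemialgebraicFunOn.sub_holds (hWAd ▸ WA.isSemialgebraicFunOn_integrand)
      (hWBd ▸ WB.isSemialgebraicFunOn_integrand)
  have hWint : IntegrableOn (WA.integrand - WB.integrand) (KZ.cube (k + 1)) :=
    (hWAd ▸ WA.integrableOn).sub (hWBd ▸ WB.integrableOn)
  let W : KZ.IntegralRep (k + 1) := ⟨KZ.cube (k + 1), _, KZ.isSemialgebraic_cube, hWsa, hWint⟩
  refine ⟨W, rfl, fun y hy => ?_, ?_⟩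
  · -- the uniform bound
    have hyc : y ∈ KZ.cube (k + 1) := hy
    have bA : |WA.integrand y - volume.real A'.domain| ≤ η := by
      rw [hWAi]; exact abs_cubeAverage_sub_volume_le hA'b j L hboxA' hη0 gapA hyc
    have bB : |WB.integrand y - volume.real B'.domain| ≤ η := by
      rw [hWBi]; exact abs_cubeAverage_sub_volume_le hB'b j L hboxB' hη0 gapB hyc
    show |(WA.integrand y - WB.integrand y) - KZ.eval c| ≤ ε
    rw [hval]
    rw [abs_le] at bA bB ⊢
    obtain ⟨a1, a2⟩ := bA
    obtain ⟨b1, b2⟩ := bB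
    constructor <;> linarith
  · -- the moves
    have eW : KZ.of WA - KZ.of W - KZ.of WB ∈ KZ.relations :=
      KZ.integrandAddRel_subset_relations ⟨k + 1, WA, W, WB, hWAd.symm ▸ rfl, by rw [hWBd, hWAd],
        fun y _ => by simp [W], rfl⟩
    have : c - KZ.of W = (c - (KZ.of A - KZ.of B)) + (KZ.of A - KZ.of A') - (KZ.of B - KZ.of B') +
        (KZ.of A' - KZ.of WA) - (KZ.of B' - KZ.of WB) + (KZ.of WA - KZ.of W - KZ.of WB) := by abel
    rw [this]
    exact KZ.relations.add_mem (KZ.relations.sub_mem (KZ.relations.add_mem (KZ.relations.sub_mem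
      (KZ.relations.add_mem e eA) eB) eWA) eWB) eW

/-- **Small-integrand normal form of the kernel**: a formal combination of value `0` is, modulo
the moves, a cube integral of a uniformly arbitrarily small `ℚ`-semialgebraic integrand.
[folklore] -/
theorem exists_cubeRep_abs_integrand_le (c : KZ.FormalRep) (hc : KZ.eval c = 0) :
    ∃ m : ℕ, ∀ ε : ℝ, 0 < ε → ∃ W : KZ.IntegralRep m, W.domain = KZ.cube m ∧
      (∀ y ∈ W.domain, |W.integrand y| ≤ ε) ∧ c - KZ.of W ∈ KZ.relations := by
  obtain ⟨m, h⟩ := exists_cubeRep_integrand_sub_eval_le c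
  refine ⟨m, fun ε hε => ?_⟩
  obtain ⟨W, hWd, hWb, hWr⟩ := h ε hε
  exact ⟨W, hWd, fun y hy => by simpa [hc] using hWb y hy, hWr⟩

/-! ### Corollaries: sup-continuous invariants, and the crux as a closedness statement -/

/-- **No sup-continuous invariant sees the kernel.** A move-invariant additive
`θ : KZ.FormalRep →+ ℝ` which is continuous at `0` in the sup norm of cube integrands (in each
dimension: uniformly small integrands on `[0,1]^m` have small `θ`) vanishes on every formal
combination of value `0`; in particular it never separates two representations of one number. For
ARBITRARY move-invariant functionals this vanishing is the crux `KernelForm` (Conjecture 1).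
[folklore] -/
theorem moveInvariant_eq_zero_of_supContinuous {θ : KZ.FormalRep →+ ℝ}
    (h0 : ∀ c ∈ KZ.relations, θ c = 0)
    (hcont : ∀ (m : ℕ) (δ : ℝ), 0 < δ → ∃ ε : ℝ, 0 < ε ∧ ∀ W : KZ.IntegralRep m,
      W.domain = KZ.cube m → (∀ y ∈ W.domain, |W.integrand y| ≤ ε) → |θ (KZ.of W)| ≤ δ)
    {c : KZ.FormalRep} (hc : KZ.eval c = 0) : θ c = 0 := by
  obtain ⟨m, h⟩ := exists_cubeRep_abs_integrand_le c hc
  refine abs_nonpos_iff.mp (le_of_forall_pos_le_add fun δ hδ => ?_)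
  obtain ⟨ε, hε, hW⟩ := hcont m δ hδ
  obtain ⟨W, hWd, hWb, hWr⟩ := h ε hε
  have h1 : θ c = θ (KZ.of W) := by
    have h' := h0 _ hWr
    rwa [map_sub, sub_eq_zero] at h'
  rw [zero_add, h1]
  exact hW W hWd hWb

/-- **No `L¹`-continuous invariant sees the kernel** (a fortiori): a move-invariant additive
`θ : KZ.FormalRep →+ ℝ` which is continuous at `0` in the `L¹` norm of cube integrands vanishes on
`ker eval` (an `L¹`-small bound follows from a sup-small one on the unit cube). [folklore] -/
theorem moveInvariant_eq_zero_of_l1Continuous {θ : KZ.FormalRep →+ ℝ}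
    (h0 : ∀ c ∈ KZ.relations, θ c = 0)
    (hcont : ∀ (m : ℕ) (δ : ℝ), 0 < δ → ∃ ε : ℝ, 0 < ε ∧ ∀ W : KZ.IntegralRep m,
      W.domain = KZ.cube m → ∫ y in W.domain, |W.integrand y| ≤ ε → |θ (KZ.of W)| ≤ δ)
    {c : KZ.FormalRep} (hc : KZ.eval c = 0) : θ c = 0 := by
  refine moveInvariant_eq_zero_of_supContinuous h0 (fun m δ hδ => ?_) hc
  obtain ⟨ε, hε, hW⟩ := hcont m δ hδ
  refine ⟨ε, hε, fun W hWd hWb => hW W hWd ?_⟩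
  calc ∫ y in W.domain, |W.integrand y| ≤ ∫ _ in W.domain, ε :=
        setIntegral_mono_on W.integrableOn.abs (integrableOn_const (by rw [hWd]; simp))
          (KZ.IntegralRep.measurableSet_domain_holds W) fun y hy => hWb y hy
    _ = ε := by rw [setIntegral_const, hWd, KZ.volume_real_cube, smul_eq_mul, one_mul]

/-- **A sup-continuous real invariant of the four move sets is never separating** (the shape of
route `Neg`'s template `NegObstructionShape` /
`Literature.Barriers.KontsevichZagierPeriods.not_kz_of_moveInvariant_separating`, with `A = ℝ`):
if `ι : KZ.FormalRep →+ ℝ` kills the four move sets and is continuous at `0` in the sup norm of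
cube integrands, then `ι [r] = ι [r']` whenever `r`, `r'` represent the same number. [folklore] -/
theorem moveInvariant_sub_eq_zero_of_value_eq_of_supContinuous (ι : KZ.FormalRep →+ ℝ)
    (hι : ∀ c ∈ KZ.domainAddRel ∪ KZ.integrandAddRel ∪ KZ.changeOfVariablesRel ∪ KZ.newtonLeibnizRel,
      ι c = 0)
    (hcont : ∀ (m : ℕ) (δ : ℝ), 0 < δ → ∃ ε : ℝ, 0 < ε ∧ ∀ W : KZ.IntegralRep m,
      W.domain = KZ.cube m → (∀ y ∈ W.domain, |W.integrand y| ≤ ε) → |ι (KZ.of W)| ≤ δ)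
    {n n' : ℕ} (r : KZ.IntegralRep n) (r' : KZ.IntegralRep n') (hv : r.value = r'.value) :
    ι (KZ.of r - KZ.of r') = 0 := by
  have h0 : ∀ c ∈ KZ.relations, ι c = 0 := fun c hc =>
    (AddSubgroup.closure_le (K := ι.ker)).mpr hι hc
  exact moveInvariant_eq_zero_of_supContinuous h0 hcont
    (by rw [map_sub, KZ.eval_of, KZ.eval_of, hv, sub_self])

/-- **The crux as a closedness statement.** `KernelForm` (Conjecture 1 in kernel form) holds iff,
in every dimension, a representation on the unit cube which is move-equivalent to cube
representations of uniformly arbitrarily small integrand is move-equivalent to `0`. (`→`: such a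
representation has value `0` by soundness; `←`: by the small-integrand normal form every element of
`ker eval` is move-equivalent to such a representation.) [folklore] -/
theorem kernelForm_iff_supClosed :
    Summit.KontsevichZagierPeriods.KontsevichZagierPeriods.Theses.VietaFibre.KernelForm ↔
      ∀ (m : ℕ) (W : KZ.IntegralRep m), W.domain = KZ.cube m →
        (∀ ε : ℝ, 0 < ε → ∃ W' : KZ.IntegralRep m, W'.domain = KZ.cube m ∧
          (∀ y ∈ W'.domain, |W'.integrand y| ≤ ε) ∧ KZ.of W - KZ.of W' ∈ KZ.relations) →
        KZ.of W ∈ KZ.relations := by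
  unfold Summit.KontsevichZagierPeriods.KontsevichZagierPeriods.Theses.VietaFibre.KernelForm
  constructor
  · intro hK m W hWd hW
    refine hK _ ?_
    -- `|eval [W]| ≤ ε` for every `ε > 0`
    refine abs_nonpos_iff.mp (le_of_forall_pos_le_add fun ε hε => ?_)
    obtain ⟨W', hW'd, hW'b, hWW'⟩ := hW ε hε
    have h1 : KZ.eval (KZ.of W) = W'.value := by
      have h := KZ.eval_eq_zero_of_mem_relations hWW'
      rw [map_sub, KZ.eval_of, KZ.eval_of, sub_eq_zero] at h
      rw [KZ.eval_of, h]
    rw [zero_add, h1, KZ.IntegralRep.value]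
    calc |∫ y in W'.domain, W'.integrand y| ≤ ∫ y in W'.domain, |W'.integrand y| :=
          abs_integral_le_integral_abs
      _ ≤ ∫ _ in W'.domain, ε := by
          refine setIntegral_mono_on W'.integrableOn.abs (integrableOn_const (by
            rw [hW'd]; simp)) (KZ.IntegralRep.measurableSet_domain_holds W') fun y hy => hW'b y hy
      _ = ε := by rw [setIntegral_const, hW'd, KZ.volume_real_cube, smul_eq_mul, one_mul]
  · intro h c hc
    obtain ⟨m, hm⟩ := exists_cubeRep_abs_integrand_le c hc
    obtain ⟨W, hWd, -, hWr⟩ := hm 1 one_pos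
    have hW : KZ.of W ∈ KZ.relations := by
      refine h m W hWd fun ε hε => ?_
      obtain ⟨W', hW'd, hW'b, hW'r⟩ := hm ε hε
      refine ⟨W', hW'd, hW'b, ?_⟩
      have : KZ.of W - KZ.of W' = (c - KZ.of W') - (c - KZ.of W) := by abel
      rw [this]
      exact KZ.relations.sub_mem hW'r hWr
    have : c = (c - KZ.of W) + KZ.of W := by abel
    rw [this]
    exact KZ.relations.add_mem hWr hW

/-- **The sup-continuous part of the crux holds** (restatement of
`moveInvariant_eq_zero_of_supContinuous` in the shape of `kernelForm_iff_forall_moveInvariant` of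
`VietaFibreKernelFormMonotoneInvariants.lean`). [folklore] -/
theorem kernelForm_supContinuousPart :
    ∀ θ : KZ.FormalRep →+ ℝ, (∀ c ∈ KZ.relations, θ c = 0) →
      (∀ (m : ℕ) (δ : ℝ), 0 < δ → ∃ ε : ℝ, 0 < ε ∧ ∀ W : KZ.IntegralRep m,
        W.domain = KZ.cube m → (∀ y ∈ W.domain, |W.integrand y| ≤ ε) → |θ (KZ.of W)| ≤ δ) →
      ∀ c, KZ.eval c = 0 → θ c = 0 :=
  fun _ h0 hcont _ hc => moveInvariant_eq_zero_of_supContinuous h0 hcont hc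

end Summit.KontsevichZagierPeriods.KernelForm.LocaliseAtValuePrime

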